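import Literature.AlgebraicGeometry.AbelianSchemes.SerreTensorFrobeniusTwist
import Literature.AlgebraicGeometry.Motives.AbelianVarietyFrobeniusKernelTorsion
import Literature.AlgebraicGeometry.Motives.AbelianVarietyEtaleIsogenyFrobeniusKernel
import Literature.AlgebraicGeometry.GroupSchemes.InfinitesimalToUnramifiedTrivial
import Literature.AlgebraicGeometry.GroupSchemes.KernelRecognitionByRank
import HarnessLib

/-!
# Assembling the inclusion `A[F_q] ⊆ A[π₀]`: one-point-meets-étale, the étale-kernel tower, and `π₀ = π₀ε + q·c`

Topic `Literature/AlgebraicGeometry/GroupSchemes`; namespaces `Literature.AlgebraicGeometry.GroupSchemes.GroupSchemeKernel` (§1, group objects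
of `Over S`, any base) and `Literature.AlgebraicGeometry.AbelianSchemes.AbelianSchemeOver` (§2–§3, abelian varieties with an `𝒪`-action, the
currency of ★ `RelFrobeniusVersusEndomorphism`).  THEOREMS ONLY (no definition, no named fact, no instance, no notation, no `sorry`).  Cell
`hodgecm-mathlib` (D-0151), FLOOR 0, P6 «MOD programme» (crux hLiu418 = stmt-HodgeConjecture-24832, `--supports`, count-neutral): organ
**(O-δ) «MULT-BLOCK ∕ FROB₀-UNIT», part 2 «INCLUSION ASSEMBLY»** of desk F0P6a-plan (g1)'s ORGAN DEALS #1 (2026-09-01; lead hand B-p17).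
Part 1 (`KernelRecognitionByRank`) turns the inclusion `Ker F_q ⊆ Ker ι(π₀)` plus the degree count into the EQUALITY `A₀[F_q] = A₀[π₀]`
(HEART-FROB v4.1 §0∕§B); this file ASSEMBLES THE INCLUSION from the two inputs the heart's FROB₀∕BANAL fields provide at a special point:
(E) an element `a ∈ 𝒪` with ÉTALE kernel `Ker ι(a)` (the étale place `c•w` and the étale banal places: `a ≡ 0` there), and (D) the ideal
arithmetic of `(π₀) = 𝔭_w^{d_w}·𝔟` («`π₀` absorbs all of `q` at the multiplicative places, is a unit at the étale ones»), spelled with no ideal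
theory as two identities in `𝒪`: `π₀ = π₀·ε + q·c` and `a^d·ε = q·c′` (by CRT: `ε ≡ 1` at the étale places, `ε ≡ 0 mod u^{v_u(q)}` at the
multiplicative ones).  HC_CM is proved only modulo the printed citations until rung 0 closes; this file is generic and changes no count.

THE MATHEMATICS.  (§1, [Tate1997FiniteFlatGroupSchemes] (3.7), [MumfordAV1970] §14: a finite group scheme over a field that is both
infinitesimal and étale is trivial.)  Let `f : G → H`, `u : G → H″` be homomorphisms of `S`-group schemes to separated targets with `Ker f`
ONE POINT and `Ker u` ÉTALE over `S`.  A `T`-point `t` of `G` killed by both `f` and `u` factors through `K′ := Ker(ι_{Ker f} ≫ u)`, a closed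
subscheme of `Ker f` (hence one point) and a closed subgroup of `Ker u` (hence trivial: ★ `isIso_unit_of_subsingleton_of_isClosedImmersion_of_etale`,
[EGAIV4] (17.4.1): unramified + one point + a section ⟹ the section is an isomorphism), so `t = 1`.  (§2, [MumfordAV1970] §15 p. 146 and
[SGA3I] VII_A 4.1: `F_{A∕k}` is natural, `ι(a) ≫ F = F ≫ ι^{(q)}(a)`.)  For an abelian variety `A∕k` with `𝒪`-action `ι` and `a ∈ 𝒪` with
`Ker ι(a)` étale, induction on `m` gives the ÉTALE-KERNEL TOWER: a point killed by `F = Fⁿ_{A∕k}` and by `ι(a^m)` is trivial («`A[F_q] ∩ A[a^∞] = 0`»,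
the line `A₀[e^∞][F_q] = 0` of HEART-FROB §B).  (§3, [MumfordAV1970] §15 ∕ [EdixhovenVanDerGeerMoonenAV] Ch. 5 §2: `V ∘ F = [q]`, so `Ker F ⊆ A[q]`,
★ (FK0) `kerι_relFrobenius_comp_pow_zsmul_id`.)  Hence `ι(q·c)` kills `Ker F`; if `a^d·ε = q·c′` then `ι(ε)` maps `Ker F` into
`Ker F ∩ Ker ι(a^d) = 0`, i.e. `ι(ε)` kills `Ker F`; and if `π₀ = π₀·ε + q·c` then `ι(π₀) = ι(π₀)ι(ε) + ι(c)[q]` kills `Ker F`: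
**`Ker Fⁿ_{A∕k} ⊆ Ker ι(π₀)`** — the hypothesis `hle` of ★ `KernelRecognitionByRank.comp_relFrobenius_eq_one_iff_of_kerι_comp_eq_one_of_finrank_eq`.

* §1 **`comp_eq_one_of_subsingleton_ker_of_etale_ker`** (any base `S`).
* §2 `comp_i_comp_relFrobeniusHom_eq_one` (`t ∈ Ker F ⟹ ι(a)t ∈ Ker F`), **`eq_one_of_comp_relFrobeniusHom_eq_one_of_comp_i_pow_eq_one`** (the tower).
* §3 `kerι_relFrobeniusHom_comp_i_natCast_pow` (`ι(q)` kills `Ker F`), `kerι_relFrobeniusHom_comp_i_eq_one_of_mul_eq_natCast_mul`,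
  `kerι_relFrobeniusHom_comp_i_eq_one_of_decomp` (`π₀ = π₀ε + qc`, `ι(ε)` kills ⟹ `ι(π₀)` kills), `kerι_relFrobeniusHom_comp_i_eq_one_of_etale_ker`
  (`Ker ι(a)` étale, `a^d ε = q c′` ⟹ `ι(ε)` kills), **`kerι_relFrobeniusHom_comp_i_eq_one_of_decomp_of_etale_ker`** (the assembled inclusion).
* §4 **`comp_relFrobeniusHom_eq_one_iff_comp_i_eq_one_of_decomp_of_etale_ker`** (+ the degree count ⟹ `A[F_q] = A[π₀]` on points, via
  ★ `KernelRecognitionByRank`), and the primed form with the rank read on `ι(π₀)`.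

## References
* [Tate1997FiniteFlatGroupSchemes] J. Tate, *Finite flat group schemes*, in Cornell–Silverman–Stevens (1997), (3.7) (connected–étale sequence;
  a connected étale group over a field is trivial).
* [MumfordAV1970] D. Mumford, *Abelian Varieties* (1970), §14 (étale and local group schemes), §15 (p. 146: the relative Frobenius `F_{A∕k}`).
* [EdixhovenVanDerGeerMoonenAV] B. Edixhoven, G. van der Geer, B. Moonen, *Abelian Varieties* (draft), Ch. 5 §2 (`V ∘ F = [p]`).
* [SGA3I] M. Demazure, A. Grothendieck (eds.), *SGA 3, Tome I*, Exp. VII_A 4.1 (functoriality of the relative Frobenius).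
* [EGAIV4] A. Grothendieck, *EGA IV₄*, Publ. Math. IHÉS 32 (1967), (17.4.1) (unramified morphisms and sections).
* [GortzWedhorn2020] U. Görtz, T. Wedhorn, *Algebraic Geometry I* (2nd ed. 2020), Definition 4.45 (2) (p. 117) (kernels as fibre products).
* [StacksProject] The Stacks project, Tag 02KA (rank of a finite locally free morphism).
-/

set_option autoImplicit false

noncomputable section

universe u

open CategoryTheory CategoryTheory.Limits AlgebraicGeometry MonoidalCategory CartesianMonoidalCategory
open scoped MonObj

namespace Literature.AlgebraicGeometry.GroupSchemes.GroupSchemeKernel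

/-! ### §1 A point lying in a one-point closed subgroup and in an étale closed subgroup is trivial -/

section OnePointEtale

variable {S : Scheme.{u}} {G H H'' : Over S} [GrpObj G] [GrpObj H] [GrpObj H''] (f : G ⟶ H) (u : G ⟶ H'')
  [IsMonHom f] [IsMonHom u]

/-- **ONE POINT ∩ ÉTALE = TRIVIAL, on points.**  `f : G → H`, `u : G → H″` morphisms of group objects of `Over S` (homomorphisms, separated
targets) with `Ker f` a ONE-POINT scheme and `Ker u → S` ÉTALE.  Then every `T`-point `t` of `G` with `t ≫ f = 1` and `t ≫ u = 1` is trivial: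
`t` factors through `K′ = Ker(ι_{Ker f} ≫ u)`, a closed subscheme of the one-point `Ker f` and a closed subgroup of the étale `Ker u`, and such
a `K′` is the trivial group (★ `isIso_unit_of_subsingleton_of_isClosedImmersion_of_etale`).  Used with `f = Fⁿ_{A∕k}` («infinitesimal») and
`u = ι(a)` («`A[a]` étale»). [cite: Tate1997FiniteFlatGroupSchemes, (3.7)] [cite: MumfordAV1970, §14] [cite: EGAIV4, (17.4.1)]
[cite: GortzWedhorn2020, Definition 4.45 (2) (p. 117)] -/
theorem comp_eq_one_of_subsingleton_ker_of_etale_ker [IsSeparated H.hom] [IsSeparated H''.hom]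
    [Subsingleton ↥(ker f).left] [Etale (ker u).hom] {T : Over S} (t : T ⟶ G) (hf : t ≫ f = 1)
    (hu : t ≫ u = 1) : t = 1 := by
  haveI := isClosedImmersion_kerι_left_of_isSeparated f
  haveI := isClosedImmersion_kerι_left_of_isSeparated u
  haveI := isClosedImmersion_kerι_left_of_isSeparated (kerι f ≫ u)
  -- `K′ := Ker (ι_{Ker f} ≫ u)` is a closed subscheme of the one-point `Ker f`: one point
  haveI : Subsingleton ↥(ker (kerι f ≫ u)).left :=
    (kerι (kerι f ≫ u)).left.isClosedEmbedding.injective.subsingleton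
  -- and a closed subgroup of the étale `Ker u`
  have hle : (kerι (kerι f ≫ u) ≫ kerι f) ≫ u = 1 := by rw [Category.assoc, kerι_comp]
  haveI : IsClosedImmersion (kerLift (f := u) (kerι (kerι f ≫ u) ≫ kerι f) hle).left := by
    haveI : IsClosedImmersion ((kerLift (f := u) (kerι (kerι f ≫ u) ≫ kerι f) hle).left ≫ (kerι u).left) := by
      rw [← Over.comp_left, kerLift_ι, Over.comp_left]
      infer_instance
    exact IsClosedImmersion.of_comp _ (kerι u).left
  obtain ⟨hiso, -⟩ :=
    isIso_unit_of_subsingleton_of_isClosedImmersion_of_etale (kerLift (f := u) (kerι (kerι f ≫ u) ≫ kerι f) hle)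
  -- `t` factors through `K′ ≅ S`
  have htK : kerLift (f := f) t hf ≫ (kerι f ≫ u) = 1 := by rw [← Category.assoc, kerLift_ι, hu]
  have hfac : kerLift (f := kerι f ≫ u) (kerLift (f := f) t hf) htK =
      toUnit T ≫ η[ker (kerι f ≫ u)] := by
    rw [← Category.comp_id (kerLift (f := kerι f ≫ u) (kerLift (f := f) t hf) htK),
      ← IsIso.inv_hom_id (η[ker (kerι f ≫ u)] : 𝟙_ (Over S) ⟶ _), ← Category.assoc]
    congr 1
    exact toUnit_unique _ _
  calc t = kerLift (f := kerι f ≫ u) (kerLift (f := f) t hf) htK ≫ kerι (kerι f ≫ u) ≫ kerι f := by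
          rw [kerLift_ι_assoc, kerLift_ι]
    _ = toUnit T ≫ η[ker (kerι f ≫ u)] ≫ kerι (kerι f ≫ u) ≫ kerι f := by rw [hfac, Category.assoc]
    _ = 1 := by rw [← Category.assoc (η[ker (kerι f ≫ u)]), one_comp_kerι, one_comp_kerι, ← Hom.one_def]

end OnePointEtale

end Literature.AlgebraicGeometry.GroupSchemes.GroupSchemeKernel

/-! ### §2 Abelian varieties with an `𝒪`-action: the étale-kernel tower and the decomposition `π₀ = π₀ε + q c` -/

namespace Literature.AlgebraicGeometry.AbelianSchemes.AbelianSchemeOver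

open Literature.AlgebraicGeometry.Motives Literature.AlgebraicGeometry.Motives.AbelianVariety
open Literature.AlgebraicGeometry.GroupSchemes Literature.AlgebraicGeometry.GroupSchemes.GroupSchemeKernel

section Tower

variable {k : Type u} [Field k] (p : ℕ) [ExpChar k p] (n : ℕ) {A : AbelianVariety k} {O : Type*} [CommRing O]
  (act : (AbelianScheme.ofAbelianVariety A).toOver.RingAction O)

/-- **`Ker F` is `ι`-stable on points**: if `t ≫ F = 1` then `(t ≫ ι(a)) ≫ F = 1`, by the naturality `ι(a) ≫ F = F ≫ ι^{(q)}(a)` of the relative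
Frobenius (★ `RingAction.i_comp_relFrobeniusHom`). [cite: MumfordAV1970, §15 (p. 146)] [cite: SGA3I, VII_A 4.1] -/
theorem comp_i_comp_relFrobeniusHom_eq_one (a : O) {T : Over (Spec (.of k))}
    (t : T ⟶ (AbelianScheme.ofAbelianVariety A).toOver.X) (ht : t ≫ relFrobeniusHom p n A = 1) :
    (t ≫ act.i a) ≫ relFrobeniusHom p n A = 1 := by
  haveI := (act.frobeniusTwist p n).isMonHom a
  rw [Category.assoc, RingAction.i_comp_relFrobeniusHom, ← Category.assoc, ht, MonObj.one_comp]

/-- **THE ÉTALE-KERNEL TOWER: `A[F_q] ∩ A[a^m] = 0` when `A[a]` is étale.**  `k` a field of exponential characteristic `p`, `A∕k` an abelian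
variety with an `𝒪`-action `ι`, `F = Fⁿ_{A∕k}`, and `a ∈ 𝒪` with `Ker ι(a) → Spec k` ÉTALE.  Then for every `m` and every `T`-point `t` of `A`:
`t ≫ F = 1 → t ≫ ι(a^m) = 1 → t = 1`.  Induction on `m`: `ι(a^{m+1}) = ι(a) ≫ ι(a^m)`, the point `t ≫ ι(a)` again lies in `Ker F` (§2), so by
induction `t ≫ ι(a) = 1`, and then `t` lies in the one-point `Ker F` and in the étale `Ker ι(a)`: `t = 1` (§1).  This is the line
«`A₀[e^∞][F_q] = 0`» of HEART-FROB §B (étale places of the CM factor `A₀`). [cite: MumfordAV1970, §14 and §15 (p. 146)]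
[cite: Tate1997FiniteFlatGroupSchemes, (3.7)] -/
theorem eq_one_of_comp_relFrobeniusHom_eq_one_of_comp_i_pow_eq_one (a : O) (het : Etale (ker (act.i a)).hom) :
    ∀ (m : ℕ) {T : Over (Spec (.of k))} (t : T ⟶ (AbelianScheme.ofAbelianVariety A).toOver.X),
      t ≫ relFrobeniusHom p n A = 1 → t ≫ act.i (a ^ m) = 1 → t = 1 := by
  haveI := isMonHom_relFrobeniusHom p n A
  haveI := act.isMonHom a
  haveI : Subsingleton ↥(ker (relFrobeniusHom p n A)).left := subsingleton_ker_relFrobenius_left p n A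
  haveI : IsSeparated (AbelianScheme.ofAbelianVariety (A.frobeniusTwist p n)).toOver.X.hom :=
    inferInstanceAs (IsSeparated (A.frobeniusTwist p n).X.hom)
  haveI : IsSeparated (AbelianScheme.ofAbelianVariety A).toOver.X.hom := inferInstanceAs (IsSeparated A.X.hom)
  intro m
  induction m with
  | zero =>
      intro T t _ h
      rwa [_root_.pow_zero, act.i_one, Category.comp_id] at h
  | succ m ih =>
      intro T t hF h
      rw [_root_.pow_succ, act.i_mul, ← Category.assoc] at h
      have h1 : t ≫ act.i a = 1 := ih (t ≫ act.i a) (comp_i_comp_relFrobeniusHom_eq_one p n act a t hF) h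
      exact comp_eq_one_of_subsingleton_ker_of_etale_ker (relFrobeniusHom p n A) (act.i a) t hF h1

end Tower

section Decomposition

variable {k : Type u} [Field k] [PerfectField k] (p : ℕ) [Fact p.Prime] [CharP k p] (n : ℕ) {A : AbelianVariety k}
  {O : Type*} [CommRing O] (act : (AbelianScheme.ofAbelianVariety A).toOver.RingAction O)

/-- **`ι(q)` kills `Ker Fⁿ_{A∕k}`** (`q = pⁿ`, `k` perfect of characteristic `p`): `ι(q) = [q]_A = (𝟙_A)^q` (★ `RingAction.i_nsmul`, ★ `hom_zsmul_id`)
and `Ker F ⊆ A[q]` because `V ∘ F = [q]` (★ (FK0) `kerι_relFrobenius_comp_pow_zsmul_id`). [cite: MumfordAV1970, §15 (p. 146)]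
[cite: EdixhovenVanDerGeerMoonenAV, Ch. 5 §2 (`V ∘ F = [p]`)] -/
theorem kerι_relFrobeniusHom_comp_i_natCast_pow : kerι (relFrobeniusHom p n A) ≫ act.i ((p ^ n : ℕ) : O) = 1 := by
  have hq : act.i ((p ^ n : ℕ) : O) = ((((p ^ n : ℕ) : ℤ)) • 𝟙 A).hom.hom.hom := by
    rw [hom_zsmul_id, zpow_natCast, ← Nat.smul_one_eq_cast, act.i_nsmul, act.i_one]
    rfl
  rw [hq]
  exact kerι_relFrobenius_comp_pow_zsmul_id p A n

/-- `ι(x)` kills `Ker Fⁿ_{A∕k}` whenever `x = q·c` in `𝒪` (`ι(q·c) = ι(q) ≫ ι(c)`). [cite: MumfordAV1970, §15 (p. 146)]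
[cite: EdixhovenVanDerGeerMoonenAV, Ch. 5 §2 (`V ∘ F = [p]`)] -/
theorem kerι_relFrobeniusHom_comp_i_eq_one_of_mul_eq_natCast_mul (x c : O) (hx : x = ((p ^ n : ℕ) : O) * c) :
    kerι (relFrobeniusHom p n A) ≫ act.i x = 1 := by
  haveI := act.isMonHom c
  rw [hx, mul_comm, act.i_mul, ← Category.assoc, kerι_relFrobeniusHom_comp_i_natCast_pow, MonObj.one_comp]

/-- **`π₀ = π₀·ε + q·c` and `ι(ε)` kills `Ker F` ⟹ `ι(π₀)` kills `Ker F`.**  (`ι(π₀ε + qc) = (ι(ε) ≫ ι(π₀)) · (ι(q) ≫ ι(c))` in the group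
`Hom(Ker F, A)`, ★ `RingAction.i_add` ∕ `i_mul`, and both factors are `1`.)  In the heart: `ε ≡ 1` at the étale places of `A₀`, `ε ≡ 0 mod
u^{v_u(q)}` at the multiplicative ones, so `π₀(1 − ε) ∈ q𝒪` because `v_u(π₀) = v_u(q)` at the multiplicative places («`(π₀) = w^{d_w}·banal`»,
HEART-FROB §0). [cite: MumfordAV1970, §15 (p. 146)] [cite: EdixhovenVanDerGeerMoonenAV, Ch. 5 §2 (`V ∘ F = [p]`)] -/
theorem kerι_relFrobeniusHom_comp_i_eq_one_of_decomp (π₀ ε c : O) (hπ : π₀ = π₀ * ε + ((p ^ n : ℕ) : O) * c)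
    (hε : kerι (relFrobeniusHom p n A) ≫ act.i ε = 1) :
    kerι (relFrobeniusHom p n A) ≫ act.i π₀ = 1 := by
  haveI := act.isMonHom π₀
  rw [hπ, act.i_add, MonObj.comp_mul, act.i_mul, ← Category.assoc, hε, MonObj.one_comp, one_mul]
  exact kerι_relFrobeniusHom_comp_i_eq_one_of_mul_eq_natCast_mul p n act _ c rfl

/-- **`Ker ι(a)` étale and `a^d·ε = q·c′` ⟹ `ι(ε)` kills `Ker F`**: the point `ι_{Ker F} ≫ ι(ε)` lies in `Ker F` (§2) and is killed by
`ι(a^d)` (`ι(ε) ≫ ι(a^d) = ι(a^d ε) = ι(q c′)`, §3), so it is trivial by the étale-kernel tower.  In the heart: `a ≡ 0` exactly at the étale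
places of `A₀` over `p` (so `A₀[a]` is étale: `#A₀[a](κ̄) = deg ι(a)`), `d ≥ v_u(q)`. [cite: MumfordAV1970, §14 and §15 (p. 146)]
[cite: Tate1997FiniteFlatGroupSchemes, (3.7)] -/
theorem kerι_relFrobeniusHom_comp_i_eq_one_of_etale_ker (a ε c' : O) (d : ℕ) (het : Etale (ker (act.i a)).hom)
    (h : a ^ d * ε = ((p ^ n : ℕ) : O) * c') :
    kerι (relFrobeniusHom p n A) ≫ act.i ε = 1 := by
  refine eq_one_of_comp_relFrobeniusHom_eq_one_of_comp_i_pow_eq_one p n act a het d _ ?_ ?_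
  · exact comp_i_comp_relFrobeniusHom_eq_one p n act ε _ (kerι_comp _)
  · rw [Category.assoc, ← act.i_mul]
    exact kerι_relFrobeniusHom_comp_i_eq_one_of_mul_eq_natCast_mul p n act _ c' h

/-- **THE ASSEMBLED INCLUSION `Ker Fⁿ_{A∕k} ⊆ Ker ι(π₀)`.**  `k` perfect of characteristic `p`, `q = pⁿ`, `A∕k` an abelian variety with an
`𝒪`-action `ι`; `π₀, ε, c, a, c′ ∈ 𝒪` and `d` with (D) `π₀ = π₀·ε + q·c`, `a^d·ε = q·c′` and (E) `Ker ι(a) → Spec k` étale.  Then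
`ι_{Ker F} ≫ ι(π₀) = 1` — the hypothesis `hle` of ★ `KernelRecognitionByRank.comp_relFrobenius_eq_one_iff_of_kerι_comp_eq_one_of_finrank_eq`, which
with `deg ι(π₀) = q^{dim A}` (`π₀π̄₀ = q`) yields `A[F_q] = A[π₀]` (HEART-FROB v4.1 §0∕§B for the CM factor `A₀`: «`A₀[w^∞][F_q] = A₀[w^∞][ϖ^{d_w}]`,
`A₀[e^∞][F_q] = 0`, `(π₀) = w^{d_w}·banal`»), i.e. the hypothesis `hker` of ★ `RelFrobeniusVersusEndomorphism.exists_iso_relFrobeniusHom_comp_eq_i`.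
[cite: MumfordAV1970, §14 and §15 (p. 146)] [cite: Tate1997FiniteFlatGroupSchemes, (3.7)] [cite: EdixhovenVanDerGeerMoonenAV, Ch. 5 §2 (`V ∘ F = [p]`)] -/
theorem kerι_relFrobeniusHom_comp_i_eq_one_of_decomp_of_etale_ker (π₀ ε c a c' : O) (d : ℕ)
    (hπ : π₀ = π₀ * ε + ((p ^ n : ℕ) : O) * c) (het : Etale (ker (act.i a)).hom)
    (h : a ^ d * ε = ((p ^ n : ℕ) : O) * c') :
    kerι (relFrobeniusHom p n A) ≫ act.i π₀ = 1 :=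
  kerι_relFrobeniusHom_comp_i_eq_one_of_decomp p n act π₀ ε c hπ
    (kerι_relFrobeniusHom_comp_i_eq_one_of_etale_ker p n act a ε c' d het h)

end Decomposition

/-! ### §4 With the degree count: `A[F_q] = A[π₀]` (the `hker` of ★ `RelFrobeniusVersusEndomorphism`) -/

section Equality

variable {k : Type u} [Field k] [PerfectField k] (p : ℕ) [Fact p.Prime] [CharP k p] (n : ℕ) {A : AbelianVariety k}
  {O : Type*} [CommRing O] (act : (AbelianScheme.ofAbelianVariety A).toOver.RingAction O)

/-- **FROB₀ ASSEMBLED: `A[F_q] = A[π₀]`.**  Under (D) `π₀ = π₀·ε + q·c`, `a^d·ε = q·c′`, (E) `Ker ι(a)` étale, and the DEGREE COUNT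
`rank Ker ι(π₀) = p^{n·dim A}` (`= deg ι(π₀) = q^{dim A}`, from `π₀π̄₀ = q`), the kernels of `Fⁿ_{A∕k}` and of `ι(π₀)` coincide on `T`-points:
`t ≫ F = 1 ↔ t ≫ ι(π₀) = 1` (§3 for `⊆`, ★ `KernelRecognitionByRank` for equality).  This is the hypothesis `hker` of
★ `RelFrobeniusVersusEndomorphism.exists_iso_relFrobeniusHom_comp_eq_i` («`(A^{(q)}, ι^{(q)}, λ^{(q)}) ≅ (A, ι, λ)`, `F ↦ ι(π₀)`»).
[cite: MumfordAV1970, §15 (p. 146)] [cite: Tate1997FiniteFlatGroupSchemes, (3.7)] [cite: GortzWedhorn2020, Definition 4.45 (2) (p. 117)] -/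
theorem comp_relFrobeniusHom_eq_one_iff_comp_i_eq_one_of_decomp_of_etale_ker (π₀ ε c a c' : O) (d : ℕ)
    (hπ : π₀ = π₀ * ε + ((p ^ n : ℕ) : O) * c) (het : Etale (ker (act.i a)).hom)
    (h : a ^ d * ε = ((p ^ n : ℕ) : O) * c')
    [IsFinite (ker (act.i π₀)).hom] [Flat (ker (act.i π₀)).hom]
    (hdeg : ∀ s, (ker (act.i π₀)).hom.finrank s = p ^ (n * A.dim))
    {T : Over (Spec (.of k))} (t : T ⟶ (AbelianScheme.ofAbelianVariety A).toOver.X) :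
    t ≫ relFrobeniusHom p n A = 1 ↔ t ≫ act.i π₀ = 1 := by
  have hle := kerι_relFrobeniusHom_comp_i_eq_one_of_decomp_of_etale_ker p n act π₀ ε c a c' d hπ het h
  haveI : IsSeparated (AbelianScheme.ofAbelianVariety A).toOver.X.hom := inferInstanceAs (IsSeparated A.X.hom)
  haveI : IsSeparated (AbelianScheme.ofAbelianVariety (A.frobeniusTwist p n)).toOver.X.hom :=
    inferInstanceAs (IsSeparated (A.frobeniusTwist p n).X.hom)
  haveI : Flat (ker (relFrobeniusHom p n A)).hom := flat_ker_relFrobenius_hom p n A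
  refine comp_eq_one_iff_of_kerι_comp_eq_one_of_finrank_eq (relFrobeniusHom p n A) (act.i π₀) hle (fun s => ?_) t
  have h1 : (ker (relFrobeniusHom p n A)).hom.finrank s = p ^ (n * A.dim) := finrank_ker_relFrobenius_hom p n A s
  rw [h1, hdeg]

/-- The same with the degree count read on `ι(π₀)` itself: `ι(π₀)` finite flat of constant rank `p^{n·dim A}` (★
`finrank_ker_hom_eq_finrank_left`: the kernel has the rank of the isogeny). [cite: MumfordAV1970, §15 (p. 146) and §7 Application 3 (p. 63)]
[cite: StacksProject, Tag 02KA] -/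
theorem comp_relFrobeniusHom_eq_one_iff_comp_i_eq_one_of_decomp_of_etale_ker' (π₀ ε c a c' : O) (d : ℕ)
    (hπ : π₀ = π₀ * ε + ((p ^ n : ℕ) : O) * c) (het : Etale (ker (act.i a)).hom)
    (h : a ^ d * ε = ((p ^ n : ℕ) : O) * c')
    [IsFinite (act.i π₀).left] [Flat (act.i π₀).left]
    (hdeg : ∀ b, (act.i π₀).left.finrank b = p ^ (n * A.dim))
    {T : Over (Spec (.of k))} (t : T ⟶ (AbelianScheme.ofAbelianVariety A).toOver.X) :
    t ≫ relFrobeniusHom p n A = 1 ↔ t ≫ act.i π₀ = 1 := by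
  haveI := isFinite_ker_hom_of_isFinite_left (act.i π₀)
  haveI := flat_ker_hom_of_flat_left (act.i π₀)
  exact comp_relFrobeniusHom_eq_one_iff_comp_i_eq_one_of_decomp_of_etale_ker p n act π₀ ε c a c' d hπ het h
    (fun s => by rw [finrank_ker_hom_eq_finrank_left (act.i π₀) s, hdeg]) t

end Equality

end Literature.AlgebraicGeometry.AbelianSchemes.AbelianSchemeOver

end
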